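import Summits.ResolutionOfSingularities.ResolutionOfSingularities.Theorems.FloorDescent1
import Summits.ResolutionOfSingularities.ResolutionOfSingularities.Theorems.FloorCutClasses
import Summits.ResolutionOfSingularities.ResolutionOfSingularities.Theorems.MaxContactCutFloorCut
import Literature.AlgebraicGeometry.Resolution.PointBlowupFlagTranslatedStep
import HarnessLib

/-!
# FloorDescent (2/6) — §4 the cone map, frames, shears, factorization of the point transform · §5 (L1) THE LIFT LAW `lift_law`

Part of the node «FloorDescent» (decomp-res · lens-5 g34): the ORDER FLOOR cell `FloorCut.NoFloorTailsDeep` of the deep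
tight-defect column DECIDED IN KERNEL for every prime `p` and exponent `e` (statement, mechanism and honest placement in
the module docstring of `FloorDescent6`; record HOME/decomp-res-lens-5/g34/NODE-g34.md).  Verbatim slice of the farm-checked
monolith `HOME/decomp-res-lens-5/g34/FloorDescent.lean` (lines 344–684); one namespace across the six slices.

WRITER NOTE (decomp-res writer g13): after the tree lint pass (a docstring on every theorem) this slice exceeded the
400-line cap,
so its last two declarations — `translate_chartTransform` and THE LIFT LAW `lift_law` (§5 (L1)) — were moved
UNCHANGED to the head
of `FloorDescent3` (inside a replayed `section Lift`); every other declaration is exactly the lens's slice.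
-/

open MvPolynomial Finset
open scoped BigOperators Polynomial
open Literature.AlgebraicGeometry.Resolution
open Literature.AlgebraicGeometry.Resolution.Hauser2010
open Literature.AlgebraicGeometry.Resolution.PointBlowup
open Literature.AlgebraicGeometry.Resolution.HauserPerlega2024
open Summit.ResolutionOfSingularities.ResolutionOfSingularities.Theorems.TightDefectClasses

namespace Summit.ResolutionOfSingularities.ResolutionOfSingularities.Theorems.FloorDescent

noncomputable section

/-! ## §4 The cone map `σ_j`, frames, shears, and the factorization of the point transform -/

section Cone

variable {σ : Type} [DecidableEq σ] [Fintype σ] {K : Type} [Field K]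

/-- The CONE EXPONENT `d + |d|_{≠ j}·e_j`. [folklore] -/
def coneExp (j : σ) (d : σ →₀ ℕ) : σ →₀ ℕ := d + Finsupp.single j (offDeg j d)

/-- `coneExp_apply_ne`: Auxiliary step of this node's calculus, VERBATIM from the lens file (see the module
docstring); the statement is its type. [folklore] -/
theorem coneExp_apply_ne (j : σ) (d : σ →₀ ℕ) {i : σ} (hij : i ≠ j) : coneExp j d i = d i := by
  rw [coneExp, Finsupp.add_apply, Finsupp.single_apply, if_neg hij.symm, add_zero]

/-- `coneExp_apply_self`: Auxiliary step of this node's calculus, VERBATIM from the lens file (see the module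
docstring); the statement is its type. [folklore] -/
theorem coneExp_apply_self (j : σ) (d : σ →₀ ℕ) : coneExp j d j = d j + offDeg j d := by
  rw [coneExp, Finsupp.add_apply, Finsupp.single_eq_same]

/-- `offDeg_coneExp`: Auxiliary step of this node's calculus, VERBATIM from the lens file (see the module
docstring); the statement is its type. [folklore] -/
theorem offDeg_coneExp (j : σ) (d : σ →₀ ℕ) : offDeg j (coneExp j d) = offDeg j d :=
  Finset.sum_congr rfl fun _ hi => coneExp_apply_ne j d (ne_of_mem_erase hi)

/-- `coneExp_injective`: Auxiliary step of this node's calculus, VERBATIM from the lens file (see the module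
docstring); the statement is its type. [folklore] -/
theorem coneExp_injective (j : σ) : Function.Injective (coneExp (σ := σ) j) := by
  intro d e h
  have hne : ∀ i, i ≠ j → d i = e i := fun i hi => by
    rw [← coneExp_apply_ne j d hi, ← coneExp_apply_ne j e hi, h]
  have hoff : offDeg j d = offDeg j e := Finset.sum_congr rfl fun i hi => hne i (ne_of_mem_erase hi)
  ext i
  by_cases hi : i = j
  · subst hi
    have := congrArg (fun f => f i) h
    simp only [coneExp_apply_self] at this
    omega
  · exact hne i hi

/-- **The CONE MAP `σ_j`**: `y_i ↦ y_i y_j` (`i ≠ j`), `y_j ↦ y_j` — the `y_j`-chart of the point blow-up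
BEFORE division by `y_j^q`, as a `K`-algebra endomorphism. (Sources: Hauser2010, §F (chart expressions of a point blowup).) -/
def coneMap (j : σ) : MvPolynomial σ K →ₐ[K] MvPolynomial σ K :=
  MvPolynomial.aeval fun i => X i * if i = j then 1 else X j

omit [Fintype σ] in
/-- `coneMap_X_self`: Auxiliary step of this node's calculus, VERBATIM from the lens file (see the module
docstring); the statement is its type. [folklore] -/
theorem coneMap_X_self (j : σ) : coneMap j (X j : MvPolynomial σ K) = X j := by
  simp [coneMap]

omit [Fintype σ] in
/-- `coneMap_X_ne`: Auxiliary step of this node's calculus, VERBATIM from the lens file (see the module docstring);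
the statement is its type. [folklore] -/
theorem coneMap_X_ne (j : σ) {i : σ} (hij : i ≠ j) : coneMap j (X i : MvPolynomial σ K) = X i * X j := by
  simp [coneMap, hij]

/-- `coneMap_monomial`: Auxiliary step of this node's calculus, VERBATIM from the lens file (see the module
docstring); the statement is its type. [folklore] -/
theorem coneMap_monomial (j : σ) (d : σ →₀ ℕ) (c : K) :
    coneMap j (monomial d c : MvPolynomial σ K) = monomial (coneExp j d) c := by
  have hprod : (d.prod fun i k => ((X i : MvPolynomial σ K) * if i = j then 1 else X j) ^ k)
      = (d.prod fun i k => (X i : MvPolynomial σ K) ^ k) * X j ^ offDeg j d := by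
    rw [show (d.prod fun i k => ((X i : MvPolynomial σ K) * if i = j then 1 else X j) ^ k)
        = d.prod fun i k => (X i : MvPolynomial σ K) ^ k * (if i = j then 1 else X j) ^ k from
        Finsupp.prod_congr fun i _ => mul_pow _ _ _, Finsupp.prod_mul]
    congr 1
    rw [Finsupp.prod_fintype _ _ (fun i => pow_zero _)]
    rw [show (∏ i, (if i = j then (1 : MvPolynomial σ K) else X j) ^ d i)
        = ∏ i, (X j : MvPolynomial σ K) ^ (if i = j then 0 else d i) from
        Finset.prod_congr rfl fun i _ => by split_ifs <;> simp, Finset.prod_pow_eq_pow_sum]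
    congr 1
    rw [offDeg, sum_eq_erase_add _ j, if_pos rfl, add_zero]
    exact Finset.sum_congr rfl fun i hi => if_neg (ne_of_mem_erase hi)
  rw [coneMap, aeval_monomial, hprod, coneExp, ← mul_assoc, MvPolynomial.algebraMap_eq, ← monomial_eq, X_pow_eq_monomial,
    monomial_mul, mul_one]

/-- `coneMap_eq_sum`: Auxiliary step of this node's calculus, VERBATIM from the lens file (see the module
docstring); the statement is its type. [folklore] -/
theorem coneMap_eq_sum (j : σ) (G : MvPolynomial σ K) :
    coneMap j G = ∑ d ∈ G.support, monomial (coneExp j d) (coeff d G) := by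
  conv_lhs => rw [G.as_sum]
  rw [map_sum]
  exact Finset.sum_congr rfl fun d _ => coneMap_monomial j d _

/-- `coeff_coneExp_coneMap`: Auxiliary step of this node's calculus, VERBATIM from the lens file (see the module
docstring); the statement is its type. [folklore] -/
theorem coeff_coneExp_coneMap (j : σ) (G : MvPolynomial σ K) (d : σ →₀ ℕ) :
    coeff (coneExp j d) (coneMap j G) = coeff d G := by
  rw [coneMap_eq_sum, coeff_sum]
  simp only [coeff_monomial]
  rw [Finset.sum_eq_single d]
  · rw [if_pos rfl]
  · intro e _ hne; rw [if_neg (fun h => hne (coneExp_injective j h))]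
  · intro hd; rw [if_pos rfl]; exact MvPolynomial.notMem_support_iff.mp hd

/-- **`y_j^q · chart_j(G) = σ_j(G)`** when every monomial of `G` has degree `≥ q`. (Sources: Hauser2010, §F (chart
expressions).) -/
theorem X_pow_mul_chartTransform (q : ℕ) (j : σ) {G : MvPolynomial σ K} (hG : OrdGE q G) :
    X j ^ q * chartTransform q j G = coneMap j G := by
  unfold chartTransform
  rw [coneMap_eq_sum, Finset.mul_sum]
  refine Finset.sum_congr rfl fun d hd => ?_
  have hexp : Finsupp.single j q + chartExponent q j d = coneExp j d := by
    ext i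
    rw [Finsupp.add_apply, chartExponent_apply]
    by_cases hi : i = j
    · rw [hi, if_pos rfl, Finsupp.single_eq_same, coneExp_apply_self]
      have h1 := hG d hd
      have h2 := degree_eq_offDeg_add j d
      omega
    · rw [if_neg hi, Finsupp.single_apply, if_neg (Ne.symm hi), zero_add, coneExp_apply_ne j d hi]
  rw [X_pow_eq_monomial, monomial_mul, one_mul, hexp]

/-- The LINE polynomial `f(y_j)` of a one-variable polynomial `f`. [folklore] -/
def toLine (j : σ) : K[X] →ₐ[K] MvPolynomial σ K := Polynomial.aeval (X j)

omit [DecidableEq σ] [Fintype σ] in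
/-- `toLine_X`: Auxiliary step of this node's calculus, VERBATIM from the lens file (see the module docstring); the
statement is its type. [folklore] -/
theorem toLine_X (j : σ) : toLine j (Polynomial.X : K[X]) = (X j : MvPolynomial σ K) := Polynomial.aeval_X _

omit [DecidableEq σ] [Fintype σ] in
/-- `toLine_C`: Auxiliary step of this node's calculus, VERBATIM from the lens file (see the module docstring); the
statement is its type. [folklore] -/
theorem toLine_C (j : σ) (c : K) : toLine j (Polynomial.C c) = (C c : MvPolynomial σ K) := by
  rw [toLine, Polynomial.aeval_C, MvPolynomial.algebraMap_eq]

omit [DecidableEq σ] [Fintype σ] in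
/-- `constantCoeff_toLine`: Auxiliary step of this node's calculus, VERBATIM from the lens file (see the module
docstring); the statement is its type. [folklore] -/
theorem constantCoeff_toLine (j : σ) (f : K[X]) : constantCoeff (toLine j f) = f.coeff 0 :=
  calc constantCoeff (toLine j f) = MvPolynomial.aeval (0 : σ → K) (toLine j f) := by
          rw [MvPolynomial.aeval_zero, Algebra.algebraMap_self, RingHom.id_apply]
    _ = Polynomial.aeval (MvPolynomial.aeval (0 : σ → K) (X j : MvPolynomial σ K)) f := by
          rw [toLine, Polynomial.aeval_algHom_apply]
    _ = f.coeff 0 := by rw [MvPolynomial.aeval_X, Pi.zero_apply, Polynomial.coeff_zero_eq_aeval_zero]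

/-- **FRAME substitution** along a polynomial arc tangent to the `y_j`-axis:
`y_i ↦ y_i + p_i(y_j)` (`i ≠ j`), `y_j ↦ y_j`. (Sources: CossartJannsenSaito2020, Def. 7.? / §8 (well-prepared coordinates).) -/
def frame (j : σ) (p : σ → K[X]) : MvPolynomial σ K →ₐ[K] MvPolynomial σ K :=
  MvPolynomial.aeval fun i => if i = j then X j else X i + toLine j (p i)

omit [Fintype σ] in
/-- `frame_X_self`: Auxiliary step of this node's calculus, VERBATIM from the lens file (see the module docstring);
the statement is its type. [folklore] -/
theorem frame_X_self (j : σ) (p : σ → K[X]) : frame j p (X j : MvPolynomial σ K) = X j := by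
  simp [frame]

omit [Fintype σ] in
/-- `frame_X_ne`: Auxiliary step of this node's calculus, VERBATIM from the lens file (see the module docstring);
the statement is its type. [folklore] -/
theorem frame_X_ne (j : σ) (p : σ → K[X]) {i : σ} (hij : i ≠ j) :
    frame j p (X i : MvPolynomial σ K) = X i + toLine j (p i) := by
  simp [frame, hij]

omit [Fintype σ] in
/-- `frame_toLine`: Auxiliary step of this node's calculus, VERBATIM from the lens file (see the module docstring);
the statement is its type. [folklore] -/
theorem frame_toLine (j : σ) (p : σ → K[X]) (f : K[X]) : frame j p (toLine j f) = toLine j f := by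
  rw [toLine, ← Polynomial.aeval_algHom_apply, frame_X_self]

omit [Fintype σ] in
/-- `frame_X_pow_self`: Auxiliary step of this node's calculus, VERBATIM from the lens file (see the module
docstring); the statement is its type. [folklore] -/
theorem frame_X_pow_self (j : σ) (p : σ → K[X]) (n : ℕ) : frame j p (X j ^ n : MvPolynomial σ K) = X j ^ n := by
  rw [map_pow, frame_X_self]

omit [Fintype σ] in
/-- Frames with opposite arcs are mutually inverse. [folklore] -/
theorem frame_comp_frame_neg (j : σ) (p : σ → K[X]) : (frame j p).comp (frame j (-p)) = AlgHom.id K _ := by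
  refine MvPolynomial.algHom_ext fun i => ?_
  rw [AlgHom.comp_apply, AlgHom.id_apply]
  by_cases hij : i = j
  · subst hij; rw [frame_X_self, frame_X_self]
  · rw [frame_X_ne j (-p) hij, map_add, frame_X_ne j p hij, frame_toLine, Pi.neg_apply, map_neg]
    abel

omit [Fintype σ] in
/-- `frame_frame_neg`: Auxiliary step of this node's calculus, VERBATIM from the lens file (see the module
docstring); the statement is its type. [folklore] -/
theorem frame_frame_neg (j : σ) (p : σ → K[X]) (G : MvPolynomial σ K) : frame j p (frame j (-p) G) = G := by
  have := congrArg (fun f => f G) (frame_comp_frame_neg j p)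
  simpa using this

omit [Fintype σ] in
/-- `frame_neg_frame`: Auxiliary step of this node's calculus, VERBATIM from the lens file (see the module
docstring); the statement is its type. [folklore] -/
theorem frame_neg_frame (j : σ) (p : σ → K[X]) (G : MvPolynomial σ K) : frame j (-p) (frame j p G) = G := by
  have := frame_frame_neg j (-p) G
  rwa [neg_neg] at this

omit [Fintype σ] in
/-- `constantCoeff_frame_X`: Auxiliary step of this node's calculus, VERBATIM from the lens file (see the module
docstring); the statement is its type. [folklore] -/
theorem constantCoeff_frame_X (j : σ) (p : σ → K[X]) (hp : ∀ i, (p i).coeff 0 = 0) (i : σ) :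
    constantCoeff (frame j p (X i) : MvPolynomial σ K) = 0 := by
  by_cases hij : i = j
  · subst hij; rw [frame_X_self, constantCoeff_X]
  · rw [frame_X_ne j p hij, map_add, constantCoeff_X, constantCoeff_toLine, hp i, add_zero]

omit [Fintype σ] in
/-- A frame substitution (no constant terms) does not change the constant coefficient. [folklore] -/
theorem constantCoeff_frame (j : σ) (p : σ → K[X]) (hp : ∀ i, (p i).coeff 0 = 0) (G : MvPolynomial σ K) :
    constantCoeff (frame j p G) = constantCoeff G := by
  have h : (constantCoeff : MvPolynomial σ K →+* K).comp (frame j p).toRingHom = constantCoeff := by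
    refine MvPolynomial.ringHom_ext (fun r => ?_) (fun i => ?_)
    · show constantCoeff (frame j p (C r)) = constantCoeff (C r)
      rw [frame, MvPolynomial.aeval_C, MvPolynomial.algebraMap_eq]
    · show constantCoeff (frame j p (X i)) = constantCoeff (X i)
      rw [constantCoeff_frame_X j p hp i, constantCoeff_X]
  exact RingHom.congr_fun h G

omit [Fintype σ] in
/-- `OrdGE.frame`: Auxiliary step of this node's calculus, VERBATIM from the lens file (see the module docstring);
the statement is its type. [folklore] -/
theorem OrdGE.frame {q : ℕ} {F : MvPolynomial σ K} (hF : OrdGE q F) (j : σ) (p : σ → K[X])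
    (hp : ∀ i, (p i).coeff 0 = 0) : OrdGE q (FloorDescent.frame j p F) :=
  hF.aeval (fun i => if i = j then X j else X i + toLine j (p i)) fun i => by
    simpa only [FloorDescent.frame, MvPolynomial.aeval_X] using constantCoeff_frame_X j p hp i

/-- The SHEAR `y_i ↦ y_i + b_i y_j` (`i ≠ j`): the frame of the LINE arc `y_i = b_i y_j`. (Sources:
HauserPerlega2024, §4 (y_t = y + tx).) -/
def shearArc (b : σ → K) : σ → K[X] := fun i => Polynomial.C (b i) * Polynomial.X

omit [DecidableEq σ] [Fintype σ] in
/-- `shearArc_coeff_zero`: Auxiliary step of this node's calculus, VERBATIM from the lens file (see the module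
docstring); the statement is its type. [folklore] -/
theorem shearArc_coeff_zero (b : σ → K) (i : σ) : (shearArc b i).coeff 0 = 0 := by
  simp [shearArc]

omit [DecidableEq σ] [Fintype σ] in
/-- `toLine_shearArc`: Auxiliary step of this node's calculus, VERBATIM from the lens file (see the module
docstring); the statement is its type. [folklore] -/
theorem toLine_shearArc (j : σ) (b : σ → K) (i : σ) : toLine j (shearArc b i) = C (b i) * X j := by
  rw [shearArc, map_mul, toLine_C, toLine_X]

omit [Fintype σ] in
/-- **Translation after the cone map is the cone map after the shear** (`b_j = 0`):
`τ_b ∘ σ_j = σ_j ∘ shear_b`. (Sources: HauserPerlega2024, §4 p. 779.) -/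
theorem translate_coneMap (j : σ) (b : σ → K) (hbj : b j = 0) (G : MvPolynomial σ K) :
    PointBlowup.translate b (coneMap j G) = coneMap j (frame j (shearArc b) G) := by
  have h : (MvPolynomial.aeval fun i => (X i + C (b i) : MvPolynomial σ K)).comp (coneMap j)
      = (coneMap j).comp (frame j (shearArc b)) := by
    refine MvPolynomial.algHom_ext fun i => ?_
    rw [AlgHom.comp_apply, AlgHom.comp_apply]
    by_cases hij : i = j
    · subst hij
      rw [coneMap_X_self, frame_X_self, coneMap_X_self, aeval_X, hbj, C_0, add_zero]
    · rw [coneMap_X_ne j hij, map_mul, aeval_X, aeval_X, hbj, C_0, add_zero, frame_X_ne j _ hij, map_add,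
        coneMap_X_ne j hij, toLine_shearArc, map_mul, algHom_C, coneMap_X_self]
      simp only [MvPolynomial.algebraMap_eq]
      ring
  exact DFunLike.congr_fun h G

end Cone

/-! ## §5 (L1) THE LIFT LAW — `ArcCond m` at stage `t+1` in a `j`-based frame lifts to `ArcCond (m+1)` at
stage `t` (same chart index `j`), by pure exponent arithmetic through the cone map. -/

section Lift

variable {σ : Type} [DecidableEq σ] [Fintype σ] {K : Type} [Field K]

/-- **(L1, arithmetic core) CONE LIFT.**  If `y_j^q · H = σ_j(G)` with `ord G ≥ q` and `H` satisfies the arc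
condition of depth `m`, then `G` satisfies the arc condition of depth `m + 1`: under `σ_j` the exponent
`d ↦ d + |d|_{≠j} e_j`, so `m (q − k) ≤ d_j + k − q ⟺ (m+1)(q − k) ≤ d_j` (`k = |d|_{≠ j}`).  CONSUMES: nothing
of the walk (pure algebra). [folklore] -/
theorem arcCond_succ_of_cone {j : σ} {q m : ℕ} {G H : MvPolynomial σ K} (_hG : OrdGE q G)
    (hH : ArcCond j q m H) (hGH : X j ^ q * H = coneMap j G) : ArcCond j q (m + 1) G := by
  intro d hd
  have hdG : coeff d G ≠ 0 := MvPolynomial.mem_support_iff.mp hd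
  have hc : coeff (coneExp j d) (X j ^ q * H) = coeff d G := by rw [hGH, coeff_coneExp_coneMap]
  rw [X_pow_eq_monomial, coeff_monomial_mul'] at hc
  have hle : Finsupp.single j q ≤ coneExp j d := by
    by_contra h; rw [if_neg h] at hc; exact hdG hc.symm
  rw [if_pos hle, one_mul] at hc
  set e := coneExp j d - Finsupp.single j q with he
  have heH : e ∈ H.support := MvPolynomial.mem_support_iff.mpr (by rw [hc]; exact hdG)
  have he_ne : ∀ i, i ≠ j → e i = d i := fun i hi => by
    rw [he, Finsupp.tsub_apply, Finsupp.single_apply, if_neg (Ne.symm hi), tsub_zero, coneExp_apply_ne j d hi]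
  have he_j : e j = d j + offDeg j d - q := by
    rw [he, Finsupp.tsub_apply, Finsupp.single_eq_same, coneExp_apply_self]
  have hoff : offDeg j e = offDeg j d := Finset.sum_congr rfl fun i hi => he_ne i (ne_of_mem_erase hi)
  have hqle : q ≤ d j + offDeg j d := by
    have := Finsupp.le_def.mp hle j
    rwa [Finsupp.single_eq_same, coneExp_apply_self] at this
  rcases hH e heH with hP | hineq
  · left
    rw [isPthPowerExponent_iff] at hP ⊢
    have hoffdvd : q ∣ offDeg j d :=
      Finset.dvd_sum fun i hi => by rw [← he_ne i (ne_of_mem_erase hi)]; exact hP i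
    intro i
    by_cases hi : i = j
    · rw [hi]
      have h1 := hP j
      rw [he_j] at h1
      have h2 : q ∣ d j + offDeg j d := by
        have := Nat.dvd_add h1 (dvd_refl q)
        rwa [Nat.sub_add_cancel hqle] at this
      obtain ⟨a, ha⟩ := h2
      obtain ⟨c, hc'⟩ := hoffdvd
      refine ⟨a - c, ?_⟩
      rw [mul_tsub, ← ha, ← hc']
      omega
    · rw [← he_ne i hi]; exact hP i
  · right
    rw [hoff, he_j] at hineq
    by_cases hoq : offDeg j d ≤ q
    · -- linear arithmetic over the atom `B = m * (q - offDeg j d)`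
      rw [Nat.succ_mul]
      generalize hB : m * (q - offDeg j d) = B at hineq ⊢
      omega
    · have : q - offDeg j d = 0 := by omega
      rw [this, mul_zero]; exact Nat.zero_le _

omit [Fintype σ] in
/-- Frames compose additively: `frame_j(p) ∘ frame_j(p') = frame_j(p + p')`. [folklore] -/
theorem frame_frame (j : σ) (p p' : σ → K[X]) (G : MvPolynomial σ K) :
    frame j p (frame j p' G) = frame j (p + p') G := by
  have h : (frame j p).comp (frame j p') = frame j (p + p') := by
    refine MvPolynomial.algHom_ext fun i => ?_
    rw [AlgHom.comp_apply]
    by_cases hij : i = j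
    · rw [hij, frame_X_self, frame_X_self, frame_X_self]
    · rw [frame_X_ne j p' hij, map_add, frame_X_ne j p hij, frame_toLine, frame_X_ne j _ hij, Pi.add_apply,
        map_add]
      abel
  exact DFunLike.congr_fun h G

omit [Fintype σ] in
/-- **The cone map intertwines the frame of the arc `y·r(y)` with the frame of `r`:**
`σ_j ∘ frame_j(X·r) = frame_j(r) ∘ σ_j`. [folklore] -/
theorem coneMap_frame_X_mul (j : σ) (r : σ → K[X]) (G : MvPolynomial σ K) :
    coneMap j (frame j (fun i => Polynomial.X * r i) G) = frame j r (coneMap j G) := by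
  have h : (coneMap j).comp (frame j fun i => Polynomial.X * r i) = (frame j r).comp (coneMap j) := by
    refine MvPolynomial.algHom_ext fun i => ?_
    rw [AlgHom.comp_apply, AlgHom.comp_apply]
    by_cases hij : i = j
    · rw [hij, frame_X_self, coneMap_X_self, frame_X_self]
    · have h1 : coneMap j (toLine j (Polynomial.X * r i)) = X j * toLine j (r i) := by
        rw [toLine, ← Polynomial.aeval_algHom_apply, coneMap_X_self, map_mul, Polynomial.aeval_X]
      rw [frame_X_ne j _ hij, map_add, coneMap_X_ne j hij, h1, map_mul, frame_X_ne j r hij, frame_X_self]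
      ring
  exact DFunLike.congr_fun h G

end Lift

end

end Summit.ResolutionOfSingularities.ResolutionOfSingularities.Theorems.FloorDescent
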